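import Mathlib
import Literature.NumberTheory.LFunctions.Zhang2022.AppendixBLineToCircleGeneric
import Literature.NumberTheory.LFunctions.Zhang2022.AppendixBLineShiftGeneric
import Literature.NumberTheory.LFunctions.Zhang2022.AppendixBLemma151Mu3Circles
import Literature.NumberTheory.LFunctions.Zhang2022.AppendixBPerronGeneric

/-!
# Zhang (2022) Appendix B, proof of Lemma 15.1: the line-to-circle step — the generic bound and its
# three instances `μ = 2, 3, 1` ("the right side is equal to the sum of the residues … plus an
# acceptable error")

Topic `Literature/NumberTheory/LFunctions/Zhang2022` (Landau–Siegel audit tree; verdict-neutral).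
Y. Zhang, *Discrete mean estimates and the Landau–Siegel zero*, arXiv:2211.02515v1 (2022)
[Zhang2022LandauSiegel] — **an unrefereed manuscript under adjudication; nothing in this file asserts
any claim of the manuscript beyond the estimates it PROVES.** ZHANG-L discharge lane (WP15, App. B
blocks B1/B3/B4 under leaf `Typed.Section15C.Eq15_22` / Lemma 15.1 χR), DAG node `Z22:§B.u009` (text
after the display) [Z22 p.107, tex L5298] and its `μ = 3`, `μ = 1` twins (tex L5310–L5311).

* `vline_zetaRatio_kerB_sub_circle_le` — the GENERIC bound: for `D` large, any `P_μ > 1` with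
  `log P_μ ≥ 𝓛⁹/4` and `P_μ/l₁ ≥ T`, any purely imaginary `β ≠ 0, β_j` with `‖β‖ ≤ 3α`,
  `‖(1/2πi)∫_{(1)} ζ(1+s)/ζ(1+s−β_j)·(P_μ/l₁)ˢ/((log P_μ)(s−β)²) ds − (2πi)⁻¹∮_{|s|=5α}(same)‖ ≤ C·α`
  (Part II assembly `vline_sub_circle_le_of_shift` fed with the vertical-line shift of
  `AppendixBLineShiftGeneric`, zl-closer-4);
* the instances in the shapes their consumers take, at rate `α₁ = α log T ≥ α`:
  `vline_sub_circle_le_mu3` (`(P₃, β₆)` = hypothesis `h9r` of `Skeleton.stepB_mu3R_of` /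
  `stepB_mu3R_of_perron_shift`, zl-closer-4) and `vline_sub_circle_le_mu1` (`(P₁, β₆)` = `h9r` of
  `Skeleton.stepB_u012R_of`, zl-w09-p5), via the shared packaging `vline_sub_circle_le_of_base`.
  (The `μ = 2` case `StepB_u009rR` is zl-w15-p3's `Skeleton.stepB_u009rR_holds`, `AppendixBLemma151LineShift`;
  the legs by name are `Skeleton.stepB_mu3R_holds` (`AppendixBLemma151Mu3Holds`, zl-closer-4) and
  `Skeleton.stepB_u012R_holds` (`AppendixBLemma151Mu1Holds`, zl-w09-p5), both over Part II's assembly.)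

WHAT THIS IS NOT: the residue values, Lemma 15.1, or any claim about Theorems 1–2 / Landau–Siegel zeros.

## References

* Y. Zhang, arXiv:2211.02515v1 (2022), App. B p. 107. [cite: Zhang2022LandauSiegel, App. B p.107]
-/

noncomputable section

open Complex Real Metric Set Filter Topology MeasureTheory

namespace Literature.NumberTheory.LFunctions.Zhang2022.Typed.AppendixB

open Literature.NumberTheory.LFunctions.Zhang2022.Skeleton

section Generic

variable (c' : ℝ)

/-- **The line-to-circle step of Appendix B, generic in `(P_μ, β)`**: there are an absolute `C` and a
threshold `D₀` such that for `D ≥ D₀`, every `j ∈ {1,2,3}`, every `P_μ > 1` with `log P_μ ≥ 𝓛⁹/4`, every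
`l₁ ≥ 1` with `P_μ/l₁ ≥ T`, and every purely imaginary `β ≠ 0`, `β ≠ β_j` with `‖β‖ ≤ 3α`,
`‖(1/2πi)∫_{(1)} F − (2πi)⁻¹∮_{|s|=5α} F‖ ≤ C·α` for `F(s) = ζ(1+s)/ζ(1+s−β_j)·(P_μ/l₁)ˢ/((log P_μ)(s−β)²)`.
[cite: Zhang2022LandauSiegel, App. B p.107] -/
theorem vline_zetaRatio_kerB_sub_circle_le : ∃ C : ℝ, ∃ D₀ : ℕ, ∀ D : ℕ, D₀ ≤ D →
    ∀ j ∈ ({1, 2, 3} : Finset ℕ), ∀ (Pμ : ℝ) (l₁ : ℕ) (β : ℂ), 1 < Pμ → ell D ^ 9 / 4 ≤ Real.log Pμ →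
      1 ≤ l₁ → bigT D ≤ Pμ / l₁ → β ≠ 0 → β ≠ betaJ c' D j → β.re = 0 → ‖β‖ ≤ 3 * alpha D →
      ‖vline 1 (fun s => zetaRatio c' D j s * kerB Pμ β l₁ s) -
          (2 * π * I)⁻¹ * (∮ s in C((0 : ℂ), 5 * alpha D), zetaRatio c' D j s * kerB Pμ β l₁ s)‖ ≤
        C * alpha D :=
  vline_sub_circle_le_of_shift c'
    (fun hPμ hl₁ hβ hσ => integrable_zetaRatio_kerB_line c' hPμ hl₁ hβ hσ)
    (fun hPμ hl₁ hβ hε hε1 => vline_shift_zetaRatio_kerB c' hPμ hl₁ hβ hε hε1)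

end Generic

/-! ## Side facts for the instances -/

section SideFacts

/-- `L₀ ≤ log D` once `D ≥ ⌈exp L₀⌉₊`. [folklore] -/
private theorem le_ell_of_ceil_exp_le₇ {L₀ : ℝ} {D : ℕ} (hD : ⌈Real.exp L₀⌉₊ ≤ D) : L₀ ≤ ell D := by
  have h : Real.exp L₀ ≤ D := le_trans (Nat.le_ceil _) (by exact_mod_cast hD)
  exact (Real.le_log_iff_exp_le (lt_of_lt_of_le (Real.exp_pos _) h)).mpr h

/-- `2𝓛^{1.1} ≤ 𝓛⁹/4` for `𝓛 ≥ 2` (`𝓛^{1.1} ≤ 𝓛²`, `8𝓛² ≤ 𝓛⁹`). [folklore] -/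
private theorem two_rpow_le_pow_nine_div_four {D : ℕ} (hℓ : 2 ≤ ell D) :
    2 * ell D ^ (1.1 : ℝ) ≤ ell D ^ 9 / 4 := by
  have hℓ1 : 1 ≤ ell D := by linarith
  have h11 : ell D ^ (1.1 : ℝ) ≤ ell D ^ 2 := by
    calc ell D ^ (1.1 : ℝ) ≤ ell D ^ (2 : ℝ) := Real.rpow_le_rpow_of_exponent_le hℓ1 (by norm_num)
      _ = ell D ^ 2 := by norm_cast
  have h7 : (128 : ℝ) ≤ ell D ^ 7 := by
    calc (128 : ℝ) = 2 ^ 7 := by norm_num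
      _ ≤ ell D ^ 7 := pow_le_pow_left₀ (by norm_num) hℓ 7
  have h9 : 8 * ell D ^ 2 ≤ ell D ^ 9 := by
    have : ell D ^ 9 = ell D ^ 7 * ell D ^ 2 := by ring
    rw [this]; nlinarith [pow_pos (show (0:ℝ) < ell D by linarith) 2]
  linarith

/-- **`T ≤ P_μ/l₁` on the range `l₁ < T`** whenever `log P_μ ≥ 𝓛⁹/4` and `𝓛 ≥ 2`
(`T² = e^{2𝓛^{1.1}} ≤ e^{𝓛⁹/4} ≤ P_μ`). [cite: Zhang2022LandauSiegel, §2 (2.10), (2.21)] -/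
theorem bigT_le_div_of_lt {D : ℕ} (hℓ : 2 ≤ ell D) {Pμ : ℝ} (hPμ : 0 < Pμ)
    (hlog : ell D ^ 9 / 4 ≤ Real.log Pμ) {l₁ : ℕ} (hl₁ : 1 ≤ l₁) (hlT : (l₁ : ℝ) < bigT D) :
    bigT D ≤ Pμ / l₁ := by
  have hl0 : (0 : ℝ) < l₁ := by exact_mod_cast hl₁
  have hT0 : 0 < bigT D := Real.exp_pos _
  have hT2 : bigT D * bigT D ≤ Pμ := by
    rw [bigT, ← Real.exp_add, ← Real.log_le_log_iff (Real.exp_pos _) hPμ, Real.log_exp]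
    linarith [two_rpow_le_pow_nine_div_four hℓ]
  rw [le_div_iff₀ hl0]
  calc bigT D * l₁ ≤ bigT D * bigT D := by gcongr
    _ ≤ Pμ := hT2

/-- `D ≥ 2` once `𝓛 = log D ≥ 2` (for `D ≤ 1`, `log D ≤ 0`). [folklore] -/
private theorem two_le_of_two_le_ell {D : ℕ} (hℓ : 2 ≤ ell D) : 2 ≤ D := by
  by_contra h
  push Not at h
  have hD1 : (D : ℝ) ≤ 1 := by exact_mod_cast Nat.lt_succ_iff.mp h
  have : ell D ≤ 0 := by rw [ell]; exact Real.log_nonpos (by positivity) hD1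
  linarith

/-- `α ≤ α₁` for `D ≥ 3` (`α₁ = α·𝓛^{1.1}`, `𝓛 = log D ≥ 1`). [cite: Zhang2022LandauSiegel, §2 (2.10)] -/
theorem alpha_le_alpha1 {D : ℕ} (hD : 3 ≤ D) : alpha D ≤ alpha1 D := by
  have hD3 : (3 : ℝ) ≤ D := by exact_mod_cast hD
  have hℓ1 : 1 ≤ ell D := by
    rw [ell, Real.le_log_iff_exp_le (by linarith)]
    have := Real.exp_one_lt_d9; linarith
  have hα0 : 0 ≤ alpha D := by
    rw [alpha, bigP, Real.log_exp]; exact div_nonneg Real.pi_pos.le (pow_nonneg (by linarith) _)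
  rw [alpha1, log_bigT]
  have h1 : (1 : ℝ) ≤ ell D ^ (1.1 : ℝ) := Real.one_le_rpow hℓ1 (by norm_num)
  have := mul_le_mul_of_nonneg_left h1 hα0
  linarith

end SideFacts

/-! ## The instances -/

section Instances

variable (c' : ℝ)

/-- The common packaging: from the generic bound (rate `α`) to the consumers' `ForAllLarge` shape at rate
`α₁`, for a base `Pθ D` with `log(Pθ D) ≥ 𝓛⁹/4` eventually and a pole `βθ D` with the side facts.
[cite: Zhang2022LandauSiegel, App. B p.107] -/
theorem vline_sub_circle_le_of_base {Pθ : ℕ → ℝ} {βθ : ℕ → ℂ}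
    (hside : ∃ D₁ : ℕ, ∀ D : ℕ, D₁ ≤ D → ∀ j ∈ ({1, 2, 3} : Finset ℕ),
      1 < Pθ D ∧ ell D ^ 9 / 4 ≤ Real.log (Pθ D) ∧ βθ D ≠ 0 ∧ βθ D ≠ betaJ c' D j ∧
        (βθ D).re = 0 ∧ ‖βθ D‖ ≤ 3 * alpha D ∧ 2 ≤ ell D) :
    ∃ C : ℝ, ForAllLarge fun D _ _ => ∀ j ∈ ({1, 2, 3} : Finset ℕ), ∀ l₁ : ℕ, 1 ≤ l₁ →
      l₁ ∈ nset (frakq D) → (l₁ : ℝ) < bigT D →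
        ‖vline 1 (fun s => zetaRatio c' D j s * kerB (Pθ D) (βθ D) l₁ s) -
            (2 * π * I)⁻¹ * (∮ s in C((0 : ℂ), 5 * alpha D),
              zetaRatio c' D j s * kerB (Pθ D) (βθ D) l₁ s)‖ ≤ C * alpha1 D := by
  obtain ⟨C, D₀, hgen⟩ := vline_zetaRatio_kerB_sub_circle_le c'
  obtain ⟨D₁, hs⟩ := hside
  refine ⟨max C 0, max (max D₀ D₁) 3, fun D _ χ hD _ _ j hj l₁ hl₁ _ hlT => ?_⟩
  have hD₀ : D₀ ≤ D := le_trans (le_trans (le_max_left _ _) (le_max_left _ _)) hD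
  have hD₁ : D₁ ≤ D := le_trans (le_trans (le_max_right _ _) (le_max_left _ _)) hD
  have hD3 : 3 ≤ D := le_trans (le_max_right _ _) hD
  obtain ⟨hP1, hlog, hβ0, hβb, hβre, hβ3, hℓ2⟩ := hs D hD₁ j hj
  have hT : bigT D ≤ Pθ D / l₁ := bigT_le_div_of_lt hℓ2 (by linarith) hlog hl₁ hlT
  have h := hgen D hD₀ j hj (Pθ D) l₁ (βθ D) hP1 hlog hl₁ hT hβ0 hβb hβre hβ3
  have hα0 : 0 ≤ alpha D := by
    rw [alpha, bigP, Real.log_exp]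
    exact div_nonneg Real.pi_pos.le (pow_nonneg (by linarith) _)
  have hα1 : 0 ≤ alpha1 D := le_trans hα0 (alpha_le_alpha1 hD3)
  calc _ ≤ C * alpha D := h
    _ ≤ max C 0 * alpha D := mul_le_mul_of_nonneg_right (le_max_left _ _) hα0
    _ ≤ max C 0 * alpha1 D := mul_le_mul_of_nonneg_left (alpha_le_alpha1 hD3) (le_max_right _ _)

/-- **The `μ = 3` instance** (`(P₃, β₆)`; "In case `μ = 3` the proof can be obtained with `β₆` and `P₃`
in place of `β₇` and `P₂`", App. B p. 107): the hypothesis `h9r` of `Skeleton.stepB_mu3R_of` /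
`Skeleton.stepB_mu3R_of_perron_shift` VERBATIM. [cite: Zhang2022LandauSiegel, App. B p.107] -/
theorem vline_sub_circle_le_mu3 : ∃ C : ℝ, ForAllLarge fun D _ _ =>
    ∀ j ∈ ({1, 2, 3} : Finset ℕ), ∀ l₁ : ℕ, 1 ≤ l₁ → l₁ ∈ nset (frakq D) → (l₁ : ℝ) < bigT D →
      ‖vline 1 (fun s => zetaRatio c' D j s * kerB (P3 D) (beta6 D) l₁ s) -
          (2 * π * I)⁻¹ * (∮ s in C((0 : ℂ), 5 * alpha D),
            zetaRatio c' D j s * kerB (P3 D) (beta6 D) l₁ s)‖ ≤ C * alpha1 D := by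
  refine vline_sub_circle_le_of_base c' (Pθ := P3) (βθ := beta6) ?_
  refine ⟨⌈Real.exp (max (max 2 (60 * |c'| * π)) (max (10 * π / 1) (8 * 0 * π)))⌉₊,
    fun D hD j hj => ?_⟩
  obtain ⟨hℓ2, hc, -, -, hα0, -, -⟩ := large_package c' one_pos le_rfl (le_ell_of_ceil_exp_le₇ hD)
  obtain ⟨hb6, hn6⟩ := beta6_size c' hℓ2 hc hj
  have hD2 : 2 ≤ D := two_le_of_two_le_ell hℓ2
  have hlog : ell D ^ 9 / 4 ≤ Real.log (P3 D) := by
    rw [log_P3]; have := pow_pos (show (0:ℝ) < ell D by linarith) 9; linarith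
  have hβ0 : beta6 D ≠ 0 := by intro h; rw [h, norm_zero] at hn6; linarith
  have hβb : beta6 D ≠ betaJ c' D j := by intro h; rw [h, sub_self, norm_zero] at hb6; linarith
  have hβ3 : ‖beta6 D‖ ≤ 3 * alpha D := by rw [hn6]; linarith
  exact ⟨one_lt_P3 hD2, hlog, hβ0, hβb, by simp [beta6], hβ3, hℓ2⟩

/-- **The `μ = 1` instance** (`(P₁, β₆)`; "The same argument also gives …", App. B p. 107,
`Z22:§B.u012`): the hypothesis `h9r` of `Skeleton.stepB_u012R_of` VERBATIM.
[cite: Zhang2022LandauSiegel, App. B p.107] -/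
theorem vline_sub_circle_le_mu1 : ∃ C : ℝ, ForAllLarge fun D _ _ =>
    ∀ j ∈ ({1, 2, 3} : Finset ℕ), ∀ l₁ : ℕ, 1 ≤ l₁ → l₁ ∈ nset (frakq D) → (l₁ : ℝ) < bigT D →
      ‖vline 1 (fun s => zetaRatio c' D j s * kerB (Skeleton.P1 D) (beta6 D) l₁ s) -
          (2 * π * I)⁻¹ * (∮ s in C((0 : ℂ), 5 * alpha D),
            zetaRatio c' D j s * kerB (Skeleton.P1 D) (beta6 D) l₁ s)‖ ≤ C * alpha1 D := by
  refine vline_sub_circle_le_of_base c' (Pθ := Skeleton.P1) (βθ := beta6) ?_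
  refine ⟨⌈Real.exp (max (max 2 (60 * |c'| * π)) (max (10 * π / 1) (8 * 0 * π)))⌉₊,
    fun D hD j hj => ?_⟩
  obtain ⟨hℓ2, hc, -, -, hα0, -, -⟩ := large_package c' one_pos le_rfl (le_ell_of_ceil_exp_le₇ hD)
  obtain ⟨hb6, hn6⟩ := beta6_size c' hℓ2 hc hj
  have hD2 : 2 ≤ D := two_le_of_two_le_ell hℓ2
  have hlogP1 : Real.log (Skeleton.P1 D) = 0.504 * ell D ^ 9 := by
    rw [Skeleton.P1, bigP, Real.log_rpow (Real.exp_pos _), Real.log_exp]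
  have hlog : ell D ^ 9 / 4 ≤ Real.log (Skeleton.P1 D) := by
    rw [hlogP1]; have := pow_pos (show (0:ℝ) < ell D by linarith) 9; linarith
  have hβ0 : beta6 D ≠ 0 := by intro h; rw [h, norm_zero] at hn6; linarith
  have hβb : beta6 D ≠ betaJ c' D j := by intro h; rw [h, sub_self, norm_zero] at hb6; linarith
  have hβ3 : ‖beta6 D‖ ≤ 3 * alpha D := by rw [hn6]; linarith
  exact ⟨one_lt_P1 hD2, hlog, hβ0, hβb, by simp [beta6], hβ3, hℓ2⟩

end Instances

end Literature.NumberTheory.LFunctions.Zhang2022.Typed.AppendixB
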